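import Summits.BirchSwinnertonDyer.BirchSwinnertonDyer.Theorems.PrintX10bControlGlueOfClausesKS
import Summits.BirchSwinnertonDyer.BirchSwinnertonDyer.Theorems.PrintX9AnticyclotomicFormalGroupH1
import Literature.NumberTheory.EllipticCurves.KummerLeStrictKernelOfReductionProofs
import Literature.NumberTheory.EllipticCurves.KummerImageOfFormalGroupH1TrivialProofs
import Literature.NumberTheory.EllipticCurves.HeegnerHypothesisConjugatePlaceProofs
import HarnessLib

/-!
# `kummerStrictOnFrames_holds` — the frame-restricted Kummer = strict equation (Greenberg LNM 1716
# Prop. 2.4 / Coates–Greenberg Prop. 4.3 on the anticyclotomic frames) IS A THEOREM (CG-FRAME (KS-asm))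

Cell `pub/bsd-print-x9`, road CG-FRAME (pen g14 «GO w3: CG-FRAME» 2026-08-29T00:29:56Z), item
stmt-BirchSwinnertonDyer-23237 `MuInequalityCoherentPairOfPrint` on routes `PrintX9` / `PrintX10b`
(= the shared μ-crux 23428 `MuInequalityCoherentPairOfPrintCG` WITHOUT its cite-only leaf
hCG = `Greenberg1999.imKummer_eq_strictCondition_goodOrdinary_numberField`, Greenberg LNM 1716 Prop. 2.4
for EVERY number field and ramified `ℤ_p`-tower).  THEOREMS ONLY; no Theses import.

The letter `HeegnerMuPartControlGlue.Stmt.kummerStrictOnFrames` (x10b-p1 LEAD g10, file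
`PrintX10bControlGlueOfClausesKS`) is the leaf RESTRICTED to the μ-chain's frames: for `K` imaginary
quadratic, `p ≠ 2` split in `K` (`SatisfiesHeegnerHypothesis p K`), `κ` anticyclotomic, `W/ℚ`
elliptic, `v ∣ p` good ordinary (ramified in `K_∞`):
`W_K.localKerOver p (ker κ) K_v = (W_K.kernelOfReductionLocalDatum p v).strictKer (ker κ)`.
This file proves it by assembling the cell's CG-FRAME bricks:

* `≤` (Kummer ⇒ strict, Greenberg Prop. 2.2 (i)): (A)
  `WeierstrassCurve.localKerOver_le_strictKer_kernelOfReduction` (x9-p1-w4, `KummerLeStrictKernelOfReductionProofs`);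
* `≥` (strict ⇒ Kummer, the Tate direction): (D)
  `strictKer_kernelOfReductionLocalDatum_le_localKerOver_of_forall_cocycle` (x10b-p1-w7,
  `KummerImageOfFormalGroupH1TrivialProofs`) fed by (C) `H¹((ker κ⁻)_v, E₁(K̄_v)) = 0`
  (`AnticyclotomicFormalGroupH1.exists_mem_localKernelOfReduction_eq_smul_sub_of_isAnticyclotomic`,
  x9-p1-w3, over Coates–Greenberg Cor. 3.2 for the cyclotomic kernel = Tate's almost étale lemma, the
  unit-trace element of an unramified quotient (B), and «`K̃_∞/K_∞⁻` unramified above split `p`»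
  (`AnticyclotomicLocalInertiaProofs`, x9-p1 LEAD));
* the second place `v̄ ≠ v` above `p` from `SatisfiesHeegnerHypothesis p K`
  (`exists_conjugatePlace_of_satisfiesHeegnerHypothesis`, x9-p1-w4, `HeegnerHypothesisConjugatePlaceProofs`).

Main decl: `HeegnerMuPartControlGlue.kummerStrictOnFrames_holds`.  Effect: the KS-twins of the
μ-chain (`…KS` letters, x10b-p1 LEAD g10 F1–F5) are fed by a kernel theorem; the closer of 23237 is
the one-liner over `HeegnerMuPartOfPrintKS.muPartStabilizedCoherentPair_of_thm161_thm411_ks` (filed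
separately, after the pen's render window).  HONEST FRAMING: a kernel discharge of the leaf ON THE
ROWS-9/10 FRAMES ONLY (the general G-2.4 for arbitrary number fields / towers stays cite-only);
the hypothesis «`v` ramified in `K_∞`» of the letter is not used; «beyond-print theorem»: no
(Greenberg LNM 1716 Prop. 2.4 / [CoGr] Prop. 4.3 on these towers); no item is closed by THIS file;
BSD is not proved by any of this; no summit statement is proved by this seat.

References: [GreenbergLNM1716] §2 Prop. 2.2 (i), Prop. 2.4 (pp. 79–84); [CoatesGreenberg1996] §3
Cor. 3.2, §4 Prop. 4.3; [Gross1991] §1 (Heegner hypothesis).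
-/

set_option autoImplicit false
-- the Theorems namespace of this sub repeats the summit name by design (D-0017 nested layout)
set_option linter.dupNamespace false

noncomputable section

open scoped Classical
open NumberField IsDedekindDomain Field WeierstrassCurve Literature.NumberTheory.GaloisRepresentations
  Literature.NumberTheory.EllipticCurves

namespace Summit.BirchSwinnertonDyer.BirchSwinnertonDyer.Theorems.HeegnerMuPartControlGlue

/-- **`kummerStrictOnFrames` holds** — the frame-restricted Kummer = strict equation of Greenberg
LNM 1716 Prop. 2.4 / Coates–Greenberg Prop. 4.3 is a kernel theorem: for `K` imaginary quadratic,
`p ≠ 2` with `SatisfiesHeegnerHypothesis p K`, `κ` anticyclotomic, `W/ℚ` elliptic and `v ∣ p` a place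
of good ordinary reduction of `W_K`,
`W_K.localKerOver p (ker κ) K_v = (W_K.kernelOfReductionLocalDatum p v).strictKer (ker κ)`.
Proof: `≤` is (A) `localKerOver_le_strictKer_kernelOfReduction` (Prop. 2.2 (i)); `≥` is (D)
`strictKer_kernelOfReductionLocalDatum_le_localKerOver_of_forall_cocycle` fed by (C)
`AnticyclotomicFormalGroupH1.exists_mem_localKernelOfReduction_eq_smul_sub_of_isAnticyclotomic`
(`H¹((ker κ)_v, E₁(K̄_v)) = 0`) at the companion place `v̄ ≠ v` supplied by the Heegner hypothesis;
the letter's ramification hypothesis is not needed.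
[cite: GreenbergLNM1716, §2 Prop. 2.4 (pp. 79–84) with Prop. 2.2 (i)] [cite: CoatesGreenberg1996, §4 Prop. 4.3 with §3 Cor. 3.2] -/
theorem kummerStrictOnFrames_holds : HeegnerMuPartControlGlue.Stmt.kummerStrictOnFrames := by
  intro K _ _ W _ p _ κ v hK hp2 hHeeg hκ hpv hgood hord _hram
  obtain ⟨vbar, hpvbar, hne⟩ := exists_conjugatePlace_of_satisfiesHeegnerHypothesis hHeeg v
  exact (W.baseChange K).localKerOver_eq_strictKer_kernelOfReduction_of_ge v p κ.kerSubgroup hpv hgood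
    hord (strictKer_kernelOfReductionLocalDatum_le_localKerOver_of_forall_cocycle (W.baseChange K) p
      κ.kerSubgroup v fun φ hφ ↦
        AnticyclotomicFormalGroupH1.exists_mem_localKernelOfReduction_eq_smul_sub_of_isAnticyclotomic
          (W.baseChange K) v hK hp2 κ hκ hpv hpvbar hne hgood φ hφ)

end Summit.BirchSwinnertonDyer.BirchSwinnertonDyer.Theorems.HeegnerMuPartControlGlue

end
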